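import Mathlib.Algebra.CharP.Lemmas
import Mathlib.Algebra.CharP.Two
import Mathlib.Algebra.MvPolynomial.Basic
import Mathlib.Algebra.MvPolynomial.CommRing
import Mathlib.RingTheory.MvPolynomial.Basic
import HarnessLib
import Mathlib.Algebra.Field.ZMod
import Mathlib.RingTheory.Ideal.Operations
import Mathlib.Tactic.LinearCombination
import Mathlib.Tactic.Ring

/-!
# K2.2 (cell res-hironaka, rung L, slot W2.2 «other cleaning operators») — in-Lean part

[OURS · L1 W2.2 / kill test K2.2, seat res-L1-k22] Evidence file, `lean check` (build_tag res).
Nothing here is a statement of Hironaka's manuscript; the manuscript's items are CANDIDATES under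
adjudication. What is typed: the two-line structural reason behind the pre-registered prediction
(PREREG-K2.2.md sha16 fa56c191924f8e8b): a TRANSLATION-type cleaning operator `y ↦ y_O = y + t`
(Benito–Villamayor p-presentation cleaning, arXiv:1004.1803 Prop 5.3 / Rem 5.7; Hironaka vertex
preparation as printed in Cossart–Jannsen–Saito LNM 2270 Thm 8.22 / 8.24) satisfies, in
characteristic `p` with `q = p^e`, the identity `g − y_O^q = ε − t^q` for `g = y^q + ε`; hence the
R05-analogue «ord(g − y_O^q) ≥ ord ε» holds as soon as `t^q` lies in the same ideal power as `ε`,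
and the R06-analogue «y_O − y ∈ 𝔪²» reduces to the ℕ-fact `q·k ≥ s > q ⇒ k ≥ 2`.
Plus the concrete instance on the R05 witness W1 (p = 2, ε = yω₁⁵ω₂ + yω₁ω₂ + ω₁⁴) under vertex
preparation (`y_CS = y + ω₁²`), in the style of `Literature/AlgebraicGeometry/Hironaka2017/DiffProduct.lean`.
Evidence: kit job j258474 (tag res): T1 ∧ T2 hold for both operators on all three R05 witnesses
(KILL-TEST K2.2 ALIVE); supplementary sweep 5 109 159 LL-heads, 0 violations.
-/

set_option linter.dupNamespace false -- mandated namespace of this single-conjunct summit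

namespace Summit.ResolutionOfSingularities.ResolutionOfSingularities.Theorems.Campaign.W22

open MvPolynomial

section General

variable {A : Type*} [CommRing A] (p : ℕ) [Fact p.Prime] [CharP A p]

/-- [OURS · L1 W2.2 / K2.2] Translation cleaning identity: in characteristic `p`, for
`g = y^(p^e) + ε` and a translated section `y + t`, one has `g − (y + t)^(p^e) = ε − t^(p^e)`.
Replaces the role of the «h» bookkeeping of Prop 9.1 p.47 for translation-type operators;
NOT a statement of the manuscript. -/
theorem sub_translate_pow_eq (e : ℕ) (y t ε : A) :
    (y ^ p ^ e + ε) - (y + t) ^ p ^ e = ε - t ^ p ^ e := by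
  rw [add_pow_char_pow (p := p)]
  ring

/-- [OURS · L1 W2.2 / K2.2] Order-safety of translation cleaning (R05-analogue, ideal-power
form): if `ε ∈ I^s` and `t^(p^e) ∈ I^s` then `g − (y+t)^(p^e) ∈ I^s` for `g = y^(p^e) + ε`.
For Benito–Villamayor's step `t = F` one has `q·ν(F) = ν(a_q) ≥ ord ε`; for a vertex dissolution
`t = c·x^v` the monomial `x^{qv}` lies in the support of `ε`; in both cases `t^q ∈ 𝔪^{ord ε}`.
NOT a statement of the manuscript. -/
theorem translate_order_safe (e : ℕ) (I : Ideal A) (s : ℕ) (y t ε : A)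
    (hε : ε ∈ I ^ s) (ht : t ^ p ^ e ∈ I ^ s) :
    (y ^ p ^ e + ε) - (y + t) ^ p ^ e ∈ I ^ s := by
  rw [sub_translate_pow_eq p e]
  exact Ideal.sub_mem _ hε ht

/-- [OURS · L1 W2.2 / K2.2] What the operators' step rules give directly: if `t ∈ I^k` then
`t^q ∈ I^(q k)` (used with `q k ≥ s` and `Ideal.pow_le_pow_right` to feed `translate_order_safe`). -/
theorem pow_mem_pow_mul (I : Ideal A) (k q : ℕ) (t : A) (ht : t ∈ I ^ k) :
    t ^ q ∈ I ^ (k * q) := by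
  rw [pow_mul]
  exact Ideal.pow_mem_pow ht q

/-- [OURS · L1 W2.2 / K2.2] ℕ-core of the R06-analogue (tail in `𝔪²`): if the translation `t`
has order `k` with `q·k ≥ s` (its `q`-th power is no lower than `ε`) and `ε` is an LL-head
remainder, `s = ord ε > q ≥ 1`, then `k ≥ 2`. NOT a statement of the manuscript. -/
theorem two_le_of_mul_ge (q k s : ℕ) (hs : q < s) (h : s ≤ q * k) : 2 ≤ k := by
  match k with
  | 0 => omega
  | 1 => omega
  | k + 2 => omega

end General

section WitnessW1

/-! ### Witness W1 of GAP-LEDGER R05 under vertex preparation (kit job j258474, row W1/CS)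
Ambient ring `𝔽₂[y, ω₁, ω₂] = MvPolynomial (Fin 3) (ZMod 2)` (`0 = y`, `1 = ω₁`, `2 = ω₂`);
`ε = yω₁⁵ω₂ + yω₁ω₂ + ω₁⁴`, `g = y² + ε`; the vertex `(2,0)` of `Δ(g; ω; y)` carries only
`ω₁⁴ = (ω₁²)²` and is dissolved by `y_CS = y + ω₁²` (CJS Thm 8.22). No definitions are introduced
(explicit terms only), so that this helper stays a pure proof file. -/

/-- [OURS · K2.2] `2 = 0` in `𝔽₂[y, ω₁, ω₂]`. -/
theorem two_eq_zero_A3 : (2 : MvPolynomial (Fin 3) (ZMod 2)) = 0 := CharTwo.two_eq_zero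

/-- [OURS · K2.2] T1 identity on W1 under CS: `g − y_CS² = yω₁⁵ω₂ + yω₁ω₂` (`= ε − ω₁⁴`). -/
theorem gW1_sub_yCS_sq :
    ((X 0 ^ 2 + (X 0 * X 1 ^ 5 * X 2 + X 0 * X 1 * X 2 + X 1 ^ 4)) - (X 0 + X 1 ^ 2) ^ 2 :
      MvPolynomial (Fin 3) (ZMod 2)) = X 0 * X 1 ^ 5 * X 2 + X 0 * X 1 * X 2 := by
  linear_combination (-(X 0 * X 1 ^ 2 : MvPolynomial (Fin 3) (ZMod 2))) * two_eq_zero_A3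

/-- [OURS · K2.2] T1 on W1 under CS: `g − y_CS² ∈ 𝔪³`, `𝔪 = (y, ω₁, ω₂)` — i.e. `ord ≥ 3 = ord ε`
(the R05-analogue holds where H♭ Case (I) gives the unit `ε + 1`, prior `DiffProduct.lean`). -/
theorem gW1_sub_yCS_sq_mem_cube :
    ((X 0 ^ 2 + (X 0 * X 1 ^ 5 * X 2 + X 0 * X 1 * X 2 + X 1 ^ 4)) - (X 0 + X 1 ^ 2) ^ 2 :
      MvPolynomial (Fin 3) (ZMod 2)) ∈
      (Ideal.span ({X 0, X 1, X 2} : Set (MvPolynomial (Fin 3) (ZMod 2)))) ^ 3 := by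
  rw [gW1_sub_yCS_sq]
  set m : Ideal (MvPolynomial (Fin 3) (ZMod 2)) :=
    Ideal.span ({X 0, X 1, X 2} : Set (MvPolynomial (Fin 3) (ZMod 2)))
  have h0 : (X 0 : MvPolynomial (Fin 3) (ZMod 2)) ∈ m := Ideal.subset_span (by simp)
  have h1 : (X 1 : MvPolynomial (Fin 3) (ZMod 2)) ∈ m := Ideal.subset_span (by simp)
  have h2 : (X 2 : MvPolynomial (Fin 3) (ZMod 2)) ∈ m := Ideal.subset_span (by simp)
  have hB : (X 0 * X 1 * X 2 : MvPolynomial (Fin 3) (ZMod 2)) ∈ m ^ 3 := by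
    rw [pow_succ, pow_succ, pow_one]
    exact Ideal.mul_mem_mul (Ideal.mul_mem_mul h0 h1) h2
  have : (X 0 * X 1 ^ 5 * X 2 + X 0 * X 1 * X 2 : MvPolynomial (Fin 3) (ZMod 2)) =
      (X 0 * X 1 * X 2) * (X 1 ^ 4 + 1) := by ring
  rw [this]
  exact Ideal.mul_mem_right _ _ hB

/-- [OURS · K2.2] T2 on W1 under CS: the tail `y_CS − y = ω₁² ∈ 𝔪²` (the R06-analogue holds where
the H♭ chain gives the unit tail `y + 1`, prior `DiffProduct.lean`). -/
theorem yCS_sub_y_mem_sq :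
    ((X 0 + X 1 ^ 2) - X 0 : MvPolynomial (Fin 3) (ZMod 2)) ∈
      (Ideal.span ({X 0, X 1, X 2} : Set (MvPolynomial (Fin 3) (ZMod 2)))) ^ 2 := by
  have h1 : (X 1 : MvPolynomial (Fin 3) (ZMod 2)) ∈
      Ideal.span ({X 0, X 1, X 2} : Set (MvPolynomial (Fin 3) (ZMod 2))) :=
    Ideal.subset_span (by simp)
  have : ((X 0 + X 1 ^ 2) - X 0 : MvPolynomial (Fin 3) (ZMod 2)) = X 1 ^ 2 := by ring
  rw [this]
  exact Ideal.pow_mem_pow h1 2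

/-- [OURS · K2.2] `ε_{W1} ∈ 𝔪³` (`ord ε = 3`), so `gW1_sub_yCS_sq_mem_cube` is the inequality
`ord(g − y_CS²) ≥ ord ε` of criterion T1 at its sharp value. -/
theorem epsW1_mem_cube :
    (X 0 * X 1 ^ 5 * X 2 + X 0 * X 1 * X 2 + X 1 ^ 4 : MvPolynomial (Fin 3) (ZMod 2)) ∈
      (Ideal.span ({X 0, X 1, X 2} : Set (MvPolynomial (Fin 3) (ZMod 2)))) ^ 3 := by
  set m : Ideal (MvPolynomial (Fin 3) (ZMod 2)) :=
    Ideal.span ({X 0, X 1, X 2} : Set (MvPolynomial (Fin 3) (ZMod 2)))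
  have h0 : (X 0 : MvPolynomial (Fin 3) (ZMod 2)) ∈ m := Ideal.subset_span (by simp)
  have h1 : (X 1 : MvPolynomial (Fin 3) (ZMod 2)) ∈ m := Ideal.subset_span (by simp)
  have h2 : (X 2 : MvPolynomial (Fin 3) (ZMod 2)) ∈ m := Ideal.subset_span (by simp)
  have hB : (X 0 * X 1 * X 2 : MvPolynomial (Fin 3) (ZMod 2)) ∈ m ^ 3 := by
    rw [pow_succ, pow_succ, pow_one]
    exact Ideal.mul_mem_mul (Ideal.mul_mem_mul h0 h1) h2
  have hC : (X 1 ^ 4 : MvPolynomial (Fin 3) (ZMod 2)) ∈ m ^ 3 := by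
    have : (X 1 ^ 4 : MvPolynomial (Fin 3) (ZMod 2)) = X 1 * X 1 ^ 3 := by ring
    rw [this]
    exact Ideal.mul_mem_left _ _ (Ideal.pow_mem_pow h1 3)
  have : (X 0 * X 1 ^ 5 * X 2 + X 0 * X 1 * X 2 + X 1 ^ 4 : MvPolynomial (Fin 3) (ZMod 2)) =
      (X 0 * X 1 * X 2) * (X 1 ^ 4 + 1) + X 1 ^ 4 := by ring
  rw [this]
  exact Ideal.add_mem _ (Ideal.mul_mem_right _ _ hB) hC

/-- [OURS · K2.2] The general identity `sub_translate_pow_eq` specialised to W1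
(`p = 2`, `e = 1`, `t = ω₁²`): `g − y_CS² = ε − (ω₁²)²`. -/
theorem gW1_instance_of_general :
    ((X 0 ^ 2 + (X 0 * X 1 ^ 5 * X 2 + X 0 * X 1 * X 2 + X 1 ^ 4)) - (X 0 + X 1 ^ 2) ^ 2 :
      MvPolynomial (Fin 3) (ZMod 2)) =
      (X 0 * X 1 ^ 5 * X 2 + X 0 * X 1 * X 2 + X 1 ^ 4) - (X 1 ^ 2) ^ 2 ^ 1 := by
  have h := sub_translate_pow_eq (A := MvPolynomial (Fin 3) (ZMod 2)) 2 1 (X 0) (X 1 ^ 2)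
    (X 0 * X 1 ^ 5 * X 2 + X 0 * X 1 * X 2 + X 1 ^ 4)
  simpa using h

end WitnessW1

section AlongCentre

/-! ### K2.2-S (supplement, seat res-L1-k22 gen 2, prereg `PREREG-K2.2S.md` sha16 b32b165814763293, kit j261197):
the knock-out of a translation-cleaned head ALONG A CENTRE.
The typed re-attachment of §16's dominoes (`CampaignW22.DominoesReattach`, res-L1-type-o3 p464475; transform law
`CampaignW22.dominoes_blowup_of_knockOut_mem_pow`, res-L1-s22-pv-1 p468341) consumes a membership of the knock-out
`H_O = g − y_O^q` in a power of the ideal `P` of the centre `D`. The structural half of K2.2-S's prereg prediction is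
the following ring-level fact: if the centre lies in the top locus (`g ∈ P^q`, i.e. `D ⊂ Sing_q(g)` for a regular
`D`) and inside the operator's output hypersurface (`y_O ∈ P`, criterion A1 «Sing ⊂ Y» of Def. 9.20 p.56 in the
operator's role), then `H_O ∈ P^q` — for ANY commutative ring, no characteristic hypothesis. The job j261197 records
that the STRONGER shape `H_O ∈ P^(q+1)` is NOT automatic (it fails on GAP-LEDGER R05's witness W1 for both operators
with `D` = the ω₂-axis: the monomial `yω₁ω₂` of `H_O` has `(y, ω₁)`-degree `2 = q`), while `H_O ∈ 𝔪·P^q` holds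
there — numbers, not a theorem of this file. OURS; NOT a statement of the manuscript. -/

variable {A : Type*} [CommRing A]

/-- [OURS · L1 W2.2 / K2.2-S] Knock-out along a centre: if `g = y^(p^e) + ε ∈ P^(p^e)` (centre inside the top
locus) and the output section `y_O ∈ P` (centre inside the output hypersurface), then
`H_O = g − y_O^(p^e) ∈ P^(p^e)`. Replaces the role of the order-along-`D` input of Lem. 16.7/16.8 p.85 for ANY
replacement operator; NOT a statement of the manuscript. [folklore] -/
theorem knockOut_mem_pow_of_mem (p e : ℕ) (P : Ideal A) (y ε yO : A)
    (hg : y ^ p ^ e + ε ∈ P ^ p ^ e) (hyO : yO ∈ P) :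
    (y ^ p ^ e + ε) - yO ^ p ^ e ∈ P ^ p ^ e :=
  Ideal.sub_mem _ hg (Ideal.pow_mem_pow hyO _)

/-- [OURS · L1 W2.2 / K2.2-S] The same for translation outputs `y_O = y + t` (Benito–Villamayor steps, vertex
dissolutions): if `g ∈ P^(p^e)`, `y ∈ P` and the translation `t ∈ P`, then `g − (y + t)^(p^e) ∈ P^(p^e)`.
NOT a statement of the manuscript. [folklore] -/
theorem sub_translate_pow_mem_pow_of_mem (p e : ℕ) (P : Ideal A) (y t ε : A)
    (hg : y ^ p ^ e + ε ∈ P ^ p ^ e) (hy : y ∈ P) (ht : t ∈ P) :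
    (y ^ p ^ e + ε) - (y + t) ^ p ^ e ∈ P ^ p ^ e :=
  knockOut_mem_pow_of_mem p e P y ε (y + t) hg (Ideal.add_mem _ hy ht)

/-- [OURS · L1 W2.2 / K2.2-S] Combined with order safety at the closed point (K2.2's T1 in ideal-power form,
`H_O ∈ 𝔪^(p^e+1)`): the knock-out lies in `𝔪^(p^e+1) ⊓ P^(p^e)` — the membership from which the vanishing of
the ruled knock-out on `π⁻¹(ξ)` is read off once `𝔪^(q+1) ⊓ P^q ≤ 𝔪·P^q` is available for the centre (for `P`
generated by part of a regular system of parameters; not proved here). NOT a statement of the manuscript.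
[folklore] -/
theorem knockOut_mem_inf_of_mem (p e : ℕ) (M P : Ideal A) (y ε yO : A)
    (hT1 : (y ^ p ^ e + ε) - yO ^ p ^ e ∈ M ^ (p ^ e + 1))
    (hg : y ^ p ^ e + ε ∈ P ^ p ^ e) (hyO : yO ∈ P) :
    (y ^ p ^ e + ε) - yO ^ p ^ e ∈ M ^ (p ^ e + 1) ⊓ P ^ p ^ e :=
  Ideal.mem_inf.mpr ⟨hT1, knockOut_mem_pow_of_mem p e P y ε yO hg hyO⟩

end AlongCentre

section P3RefutedOnW1

/-! ### K2.2-S, reported column P3 as a kernel fact (kit j261337 row W1/CS, centre = the ω₂-axis)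
The re-attachment hypothesis shape `H_O ∈ P^(q+1)` (`CampaignW22.DominoesReattachAlongCentre`, p468341's
`dominoes_blowup_of_knockOut_mem_pow`) is NOT met by the vertex-prepared tail on GAP-LEDGER R05's witness W1:
with `P = (y, ω₁)` (the ideal of the ω₂-axis `= Sing₂(g)` near `ξ`) and `q = 2`, the knock-out
`H_CS = g − (y + ω₁²)² = yω₁⁵ω₂ + yω₁ω₂` (`gW1_sub_yCS_sq`) does not lie in `P³`, because every monomial of an
element of `P^k` has `(y, ω₁)`-degree `≥ k` while `yω₁ω₂` has `(y, ω₁)`-degree `2`. (It does lie in `𝔪·P²`, the P2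
shape — the kit job's monomial bookkeeping; not repeated here.) OURS; NOT a statement of the manuscript. -/

/-- [OURS · K2.2-S] Weight bookkeeping: every monomial of an element of `(y, ω₁)^k ⊂ 𝔽₂[y, ω₁, ω₂]` has
`(y, ω₁)`-degree at least `k`. [folklore] -/
theorem weight_le_of_mem_span_pair_pow (k : ℕ) :
    ∀ f : MvPolynomial (Fin 3) (ZMod 2),
      f ∈ (Ideal.span ({X 0, X 1} : Set (MvPolynomial (Fin 3) (ZMod 2)))) ^ k →
        ∀ m ∈ f.support, k ≤ m 0 + m 1 := by
  induction k with
  | zero => intro f _ m _; exact Nat.zero_le _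
  | succ k ih =>
    intro f hf
    rw [pow_succ] at hf
    refine Submodule.mul_induction_on hf ?_ ?_
    · intro a ha b hb
      -- `b ∈ span {X 0, X 1}`: induct over the span
      refine Submodule.span_induction ?_ ?_ ?_ ?_ hb
      · intro x hx m hm
        simp only [Set.mem_insert_iff, Set.mem_singleton_iff] at hx
        rcases hx with rfl | rfl
        · rw [MvPolynomial.support_mul_X] at hm
          obtain ⟨m', hm', rfl⟩ := Finset.mem_map.mp hm
          have := ih a ha m' hm'
          have h0 : (Finsupp.single (0 : Fin 3) 1 : Fin 3 →₀ ℕ) 0 = 1 := Finsupp.single_eq_same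
          have h1 : (Finsupp.single (0 : Fin 3) 1 : Fin 3 →₀ ℕ) 1 = 0 := by
            rw [Finsupp.single_apply, if_neg (by decide)]
          simp only [addRightEmbedding_apply, Finsupp.coe_add, Pi.add_apply, h0, h1]
          omega
        · rw [MvPolynomial.support_mul_X] at hm
          obtain ⟨m', hm', rfl⟩ := Finset.mem_map.mp hm
          have := ih a ha m' hm'
          have h0 : (Finsupp.single (1 : Fin 3) 1 : Fin 3 →₀ ℕ) 0 = 0 := by
            rw [Finsupp.single_apply, if_neg (by decide)]
          have h1 : (Finsupp.single (1 : Fin 3) 1 : Fin 3 →₀ ℕ) 1 = 1 := Finsupp.single_eq_same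
          simp only [addRightEmbedding_apply, Finsupp.coe_add, Pi.add_apply, h0, h1]
          omega
      · intro m hm
        simp at hm
      · intro x y _ _ hx hy m hm
        rw [mul_add] at hm
        rcases Finset.mem_union.mp (MvPolynomial.support_add hm) with h | h
        · exact hx m h
        · exact hy m h
      · intro c x _ hx m hm
        rw [smul_eq_mul, mul_left_comm] at hm
        obtain ⟨m₁, _, m₂, hm₂, rfl⟩ := Finset.mem_add.mp (MvPolynomial.support_mul _ _ hm)
        have := hx m₂ hm₂
        simp only [Finsupp.coe_add, Pi.add_apply]
        omega
    · intro x y hx hy m hm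
      rcases Finset.mem_union.mp (MvPolynomial.support_add hm) with h | h
      · exact hx m h
      · exact hy m h

/-- [OURS · K2.2-S] The monomial `yω₁ω₂` lies in the support of W1's vertex-prepared knock-out
`yω₁⁵ω₂ + yω₁ω₂`. [folklore] -/
theorem single_mem_support_HCS :
    (Finsupp.single 0 1 + Finsupp.single 1 1 + Finsupp.single 2 1 : Fin 3 →₀ ℕ) ∈
      (X 0 * X 1 ^ 5 * X 2 + X 0 * X 1 * X 2 : MvPolynomial (Fin 3) (ZMod 2)).support := by
  rw [MvPolynomial.mem_support_iff]
  have h1 : (X 0 * X 1 ^ 5 * X 2 : MvPolynomial (Fin 3) (ZMod 2)) =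
      monomial (Finsupp.single 0 1 + Finsupp.single 1 5 + Finsupp.single 2 1) 1 := by
    simp [X, monomial_mul, monomial_pow]
  have h2 : (X 0 * X 1 * X 2 : MvPolynomial (Fin 3) (ZMod 2)) =
      monomial (Finsupp.single 0 1 + Finsupp.single 1 1 + Finsupp.single 2 1) 1 := by
    simp [X, monomial_mul]
  rw [h1, h2, coeff_add, coeff_monomial, coeff_monomial, if_neg, if_pos rfl]
  · decide
  · intro h
    have := DFunLike.congr_fun h 1
    simp at this

/-- [OURS · K2.2-S] **P3 refuted on W1 (CS)**: the vertex-prepared knock-out of R05's witness W1 is not in the cube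
of the ideal of the ω₂-axis: `g − (y + ω₁²)² = yω₁⁵ω₂ + yω₁ω₂ ∉ (y, ω₁)³` in `𝔽₂[y, ω₁, ω₂]` — so the named-fact
shape «knock-out ∈ 𝓘_D^(q+1) for every centre D ⊂ Sing_q(g) through ξ inside the output hypersurface» fails for
Hironaka/CJS vertex preparation already on W1 (kit j261337 reports the same for Benito–Villamayor's output `y`, whose
knock-out `ε` also carries `yω₁ω₂`). NOT a statement of the manuscript or of the cited papers. [folklore] -/
theorem HCS_W1_not_mem_axis_ideal_cube :
    ((X 0 ^ 2 + (X 0 * X 1 ^ 5 * X 2 + X 0 * X 1 * X 2 + X 1 ^ 4)) - (X 0 + X 1 ^ 2) ^ 2 :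
      MvPolynomial (Fin 3) (ZMod 2)) ∉
      (Ideal.span ({X 0, X 1} : Set (MvPolynomial (Fin 3) (ZMod 2)))) ^ 3 := by
  rw [gW1_sub_yCS_sq]
  intro h
  have := weight_le_of_mem_span_pair_pow 3 _ h _ single_mem_support_HCS
  simp at this

end P3RefutedOnW1

section P3RefutedOnW1BV

/-! ### K2.2-S, reported column P3 — Benito–Villamayor side (kit j261337 row W1/BV; seat res-L1-k22 gen 3)
On GAP-LEDGER R05's witness W1 the Benito–Villamayor cleaning makes no step at `ξ` (BV2013 §5.1 case A: the slope
`min(ν(a₁)/1, ν(a₂)/2) = min(2/1, 4/2)` is attained at `j = 1 < q`, so (5.3.1) fails and Prop. 5.3 offers no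
slope-raising translation; kernel form in `MarkedTransferCampaignW22OneDominoW1.lean`), hence its output section is `y`
itself and its knock-out is `H_BV = g − y² = ε = yω₁⁵ω₂ + yω₁ω₂ + ω₁⁴`. Like the vertex-prepared knock-out it carries the
monomial `yω₁ω₂` of `(y, ω₁)`-degree `2 < 3`, so `H_BV ∉ (y, ω₁)³`: the hypothesis shape «knock-out ∈ 𝓘_D^(q+1)» of
`CampaignW22.DominoesReattachAlongCentre` fails on W1 for BOTH operators of the kill test (j261337 tableS.json
fe7607e8cb67bbdd, column P3 = false/false; the P2 shape `𝔪·𝓘_D^q` holds). OURS; NOT a statement of the manuscript or of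
[BenitoVillamayoru2013]. -/

/-- [OURS · K2.2-S] The monomial `yω₁ω₂` lies in the support of W1's LL-head remainder
`ε = yω₁⁵ω₂ + yω₁ω₂ + ω₁⁴` (= the Benito–Villamayor knock-out `g − y²` on W1). [folklore] -/
theorem single_mem_support_epsW1 :
    (Finsupp.single 0 1 + Finsupp.single 1 1 + Finsupp.single 2 1 : Fin 3 →₀ ℕ) ∈
      (X 0 * X 1 ^ 5 * X 2 + X 0 * X 1 * X 2 + X 1 ^ 4 : MvPolynomial (Fin 3) (ZMod 2)).support := by
  rw [MvPolynomial.mem_support_iff]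
  have h1 : (X 0 * X 1 ^ 5 * X 2 : MvPolynomial (Fin 3) (ZMod 2)) =
      monomial (Finsupp.single 0 1 + Finsupp.single 1 5 + Finsupp.single 2 1) 1 := by
    simp [X, monomial_mul, monomial_pow]
  have h2 : (X 0 * X 1 * X 2 : MvPolynomial (Fin 3) (ZMod 2)) =
      monomial (Finsupp.single 0 1 + Finsupp.single 1 1 + Finsupp.single 2 1) 1 := by
    simp [X, monomial_mul]
  have h3 : (X 1 ^ 4 : MvPolynomial (Fin 3) (ZMod 2)) = monomial (Finsupp.single 1 4) 1 := by
    simp [X, monomial_pow]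
  rw [h1, h2, h3, coeff_add, coeff_add, coeff_monomial, coeff_monomial, coeff_monomial, if_neg, if_pos rfl,
    if_neg]
  · decide
  · intro h
    have := DFunLike.congr_fun h 1
    simp at this
  · intro h
    have := DFunLike.congr_fun h 1
    simp at this

/-- [OURS · K2.2-S] **P3 refuted on W1 (BV)**: the Benito–Villamayor knock-out of R05's witness W1 (output section `y`,
no cleaning step at `ξ`) is not in the cube of the ideal of the ω₂-axis:
`g − y² = ε = yω₁⁵ω₂ + yω₁ω₂ + ω₁⁴ ∉ (y, ω₁)³` in `𝔽₂[y, ω₁, ω₂]` (companion of `HCS_W1_not_mem_axis_ideal_cube`;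
both columns of kit j261337's P3 row for W1 are now kernel facts). NOT a statement of the manuscript or of the cited
papers. [folklore] -/
theorem HBV_W1_not_mem_axis_ideal_cube :
    ((X 0 ^ 2 + (X 0 * X 1 ^ 5 * X 2 + X 0 * X 1 * X 2 + X 1 ^ 4)) - X 0 ^ 2 :
      MvPolynomial (Fin 3) (ZMod 2)) ∉
      (Ideal.span ({X 0, X 1} : Set (MvPolynomial (Fin 3) (ZMod 2)))) ^ 3 := by
  rw [add_sub_cancel_left]
  intro h
  have := weight_le_of_mem_span_pair_pow 3 _ h _ single_mem_support_epsW1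
  simp at this

end P3RefutedOnW1BV

end Summit.ResolutionOfSingularities.ResolutionOfSingularities.Theorems.Campaign.W22
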